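import Summits.ABC.ABC.Theses.PlacewiseSzpiro
import Summits.ABC.Harvest.OpenQuestions
import Literature.NumberTheory.DiophantineGeometry.ConductorRadicalProofs
import Literature.NumberTheory.DiophantineGeometry.MinimalDiscriminantFactorizationProofs
import Literature.NumberTheory.DiophantineGeometry.MinimalDiscriminantProofs
import HarnessLib

/-!
# Route PlacewiseSzpiro — item `PlacewisePayoff` (stmt-ABC-22412): the payoff glue

`Summit.ABC.ABC.Theses.PlacewiseSzpiro.PlacewisePayoff := SingleTowerSzpiro → (∀ ε > 0, ∃ C, ∀ E/ℚ,
log |Δ_min(E)| ≤ C · N_E ^ ε)`, whose conclusion is verbatim the harvested rung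
`Summit.ABC.Harvest.SubexponentialSzpiro` (Pasten, JNT 254 (2024) §1; cell abc-harv, `OpenQuestions.lean` §1).

`SingleTowerSzpiro` (crux X1 of the line, stmt-ABC-22410) says that every finite tower of the minimal
discriminant obeys the generalized-Szpiro budget on its own: for every `ε > 0` there is `C` with
`ord_p(Δ_min(E)) · log p ≤ (6 + ε) log N_E + C` for every elliptic curve `E/ℚ` and every prime `p`.

Proof of the payoff (elementary; every input is PROVED in the tree, no named-fact hypothesis):

* `log |Δ_min| = Σ_{p ∣ Δ_min} ord_p(Δ_min) · log p` — `WeierstrassCurve.factorization_minimalDiscriminantNorm_holds`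
  (`|Δ_min| = ∏_p p ^ ord_p(Δ_min)`, Silverman AEC VIII.8) read through `Rat.HeightOneSpectrum.primesEquiv`;
* the primes of `Δ_min` are the primes of `N_E` — `WeierstrassCurve.radical_conductorNorm_eq_holds`
  (Silverman AEC VIII.11 / VII.5.1(a)), so there are `ω(N_E) ≤ log N_E / log 2` towers (`2 ^ ω(n) ≤ n`);
* with X1 at `ε = 1`: `log |Δ_min| ≤ ω(N_E) · (7 log N_E + max(C₁, 0)) ≤ (7 (log N_E)² + max(C₁,0) log N_E) / log 2`;
* `log N ≤ N^δ / δ` (`Real.log_le_rpow_div`) at `δ = ε/2` and `δ = ε` gives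
  `log |Δ_min| ≤ ((28/ε² + max(C₁,0)/ε) / log 2) · N_E ^ ε` (`N_E ≥ 1`, `WeierstrassCurve.conductorNorm_pos_holds`).

Main declarations (namespace `Summit.ABC.ABC.Theorems`):

* `PlacewiseSzpiroPayoff.log_minimalDiscriminantNorm_le_card_mul` — per-curve core: a uniform tower bound `B`
  gives `log |Δ_min| ≤ ω(N_E) · B`;
* `subexponentialSzpiro_of_singleTowerSzpiro : SingleTowerSzpiro → Summit.ABC.Harvest.SubexponentialSzpiro`
  (the named form asked for by the cell);
* `placewisePayoff_proof : Summit.ABC.ABC.Theses.PlacewiseSzpiro.PlacewisePayoff` (closes stmt-ABC-22412).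

HONESTY (D-0139/D-0140). This is the certified elementary content of the line, NOT progress on the crux
`SingleTowerSzpiro`; `SubexponentialSzpiro` (rung «A1′ — NOT abc — SUBEXP-SZPIRO», proposed) and A-PS are NOT
abc; abc is not proved by any of this; typed ≠ proved. No `sorry`, no new axiom, no `def`.
-/

noncomputable section

-- `Summit.<Summit>.<Problem>` is the mandated summit-side namespace (CONVENTIONS §2); for the
-- single-conjunct summit `ABC` the two coincide, so the duplicate `ABC.ABC` is deliberate.
set_option linter.dupNamespace false

namespace Summit.ABC.ABC.Theorems

open IsDedekindDomain UniqueFactorizationMonoid Finset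
open Summit.ABC.ABC.Theses.PlacewiseSzpiro

namespace PlacewiseSzpiroPayoff

/-! ### Elementary bookkeeping in `ℕ` -/

/-- `log n = Σ_{p ∣ n} v_p(n) · log p` for `n ≠ 0` (unique factorisation, read in `ℝ`). [folklore] -/
theorem log_natCast_eq_sum_primeFactors {n : ℕ} (hn : n ≠ 0) :
    Real.log (n : ℝ) = ∑ p ∈ n.primeFactors, (n.factorization p : ℝ) * Real.log (p : ℝ) := by
  conv_lhs => rw [Nat.prod_primeFactors_pow_factorization hn]
  push_cast
  rw [Real.log_prod]
  · exact Finset.sum_congr rfl fun p _ => by rw [Real.log_pow]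
  · intro p hp
    exact pow_ne_zero _ (by exact_mod_cast (Nat.prime_of_mem_primeFactors hp).ne_zero)

/-- `ω(n) · log 2 ≤ log n` for `n ≠ 0`: the distinct prime factors are `≥ 2` and their product
`rad n` is at most `n`. [folklore] -/
theorem card_primeFactors_mul_log_two_le {n : ℕ} (hn : n ≠ 0) :
    (n.primeFactors.card : ℝ) * Real.log 2 ≤ Real.log (n : ℝ) := by
  have h : 2 ^ n.primeFactors.card ≤ n :=
    calc 2 ^ n.primeFactors.card ≤ ∏ p ∈ n.primeFactors, p :=
          Finset.pow_card_le_prod _ _ 2 fun p hp => (Nat.prime_of_mem_primeFactors hp).two_le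
      _ = radical n := Nat.radical_eq_prod_primeFactors.symm
      _ ≤ n := Nat.radical_le_self_iff.mpr hn
  rw [← Real.log_pow]
  exact Real.log_le_log (by positivity) (by exact_mod_cast h)

/-- `(log x)² ≤ (2/ε)² · x ^ ε` for `x ≥ 1`, from `log x ≤ x^(ε/2) / (ε/2)`. [folklore] -/
theorem log_sq_le_rpow {x ε : ℝ} (hx : 1 ≤ x) (hε : 0 < ε) :
    Real.log x ^ 2 ≤ (2 / ε) ^ 2 * x ^ ε := by
  have hx0 : 0 ≤ x := by linarith
  have hlog : 0 ≤ Real.log x := Real.log_nonneg hx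
  have h := Real.log_le_rpow_div hx0 (half_pos hε)
  have h' : Real.log x ≤ (2 / ε) * x ^ (ε / 2) := by
    calc Real.log x ≤ x ^ (ε / 2) / (ε / 2) := h
      _ = (2 / ε) * x ^ (ε / 2) := by ring
  calc Real.log x ^ 2 ≤ ((2 / ε) * x ^ (ε / 2)) ^ 2 := pow_le_pow_left₀ hlog h' 2
    _ = (2 / ε) ^ 2 * (x ^ (ε / 2)) ^ 2 := by ring
    _ = (2 / ε) ^ 2 * x ^ ε := by
        congr 1
        rw [← Real.rpow_two, ← Real.rpow_mul hx0]
        ring_nf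

/-! ### Per-curve core -/

/-- **Summing the towers.** If every finite tower of the minimal discriminant of `E/ℚ` is at most `B`
(`ord_v(Δ_min) · log p_v ≤ B` for every place `v` of `ℤ`), then
`log |Δ_min(E)| ≤ ω(N_E) · B`: `log |Δ_min| = Σ_{p ∣ Δ_min} ord_p(Δ_min) log p`
(`WeierstrassCurve.factorization_minimalDiscriminantNorm_holds`) and the primes of `Δ_min` are exactly the
primes of `N_E` (`WeierstrassCurve.radical_conductorNorm_eq_holds`, Silverman AEC VIII.11). [folklore] -/
theorem log_minimalDiscriminantNorm_le_card_mul (W : WeierstrassCurve ℚ) [W.IsElliptic] {B : ℝ}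
    (h : ∀ v : HeightOneSpectrum ℤ,
      (W.ordMinimalDiscriminant v : ℝ) * Real.log (Rat.HeightOneSpectrum.natGenerator v : ℝ) ≤ B) :
    Real.log (W.minimalDiscriminantNorm ℤ : ℝ) ≤ ((W.conductorNorm ℤ).primeFactors.card : ℝ) * B := by
  have hΔ0 : W.minimalDiscriminantNorm ℤ ≠ 0 :=
    (WeierstrassCurve.minimalDiscriminantNorm_pos_holds W).ne'
  have hpf : (W.conductorNorm ℤ).primeFactors = (W.minimalDiscriminantNorm ℤ).primeFactors := by
    rw [← Nat.primeFactors_radical (W.conductorNorm ℤ),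
      WeierstrassCurve.radical_conductorNorm_eq_holds W, Nat.primeFactors_radical]
  rw [hpf, log_natCast_eq_sum_primeFactors hΔ0]
  calc ∑ p ∈ (W.minimalDiscriminantNorm ℤ).primeFactors,
        ((W.minimalDiscriminantNorm ℤ).factorization p : ℝ) * Real.log (p : ℝ)
      ≤ ∑ p ∈ (W.minimalDiscriminantNorm ℤ).primeFactors, B := by
        refine Finset.sum_le_sum fun p hp => ?_
        have hpp : p.Prime := Nat.prime_of_mem_primeFactors hp
        have hgen : Rat.HeightOneSpectrum.natGenerator
            ((Rat.HeightOneSpectrum.primesEquiv (R := ℤ)).symm ⟨p, hpp⟩) = p :=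
          congrArg Subtype.val
            ((Rat.HeightOneSpectrum.primesEquiv (R := ℤ)).apply_symm_apply ⟨p, hpp⟩)
        have hfac : (W.minimalDiscriminantNorm ℤ).factorization p =
            W.ordMinimalDiscriminant ((Rat.HeightOneSpectrum.primesEquiv (R := ℤ)).symm ⟨p, hpp⟩) := by
          conv_lhs => rw [← hgen]
          exact WeierstrassCurve.factorization_minimalDiscriminantNorm_holds W _
        have hv := h ((Rat.HeightOneSpectrum.primesEquiv (R := ℤ)).symm ⟨p, hpp⟩)
        rw [hgen] at hv
        rw [hfac]
        exact hv
    _ = ((W.minimalDiscriminantNorm ℤ).primeFactors.card : ℝ) * B := by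
        rw [Finset.sum_const, nsmul_eq_mul]

end PlacewiseSzpiroPayoff

open PlacewiseSzpiroPayoff

/-- **Payoff of the line, named form: `SingleTowerSzpiro ⟹ SubexponentialSzpiro`.** If every finite
tower obeys `ord_p(Δ_min) log p ≤ (6+ε) log N_E + C(ε)`, then for every `ε > 0`,
`log |Δ_min(E)| ≤ C'(ε) · N_E ^ ε` with `C'(ε) = (28/ε² + max(C(1),0)/ε) / log 2`: sum the towers over the
`ω(N_E) ≤ log N_E / log 2` bad primes (supp `Δ_min` = supp `N_E`) and use `log N ≤ N^δ/δ`.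
`SubexponentialSzpiro` is the harvested rung of Pasten, JNT 254 (2024) §1 («A1′ — NOT abc»). [folklore] -/
theorem subexponentialSzpiro_of_singleTowerSzpiro (hX : SingleTowerSzpiro) :
    Summit.ABC.Harvest.SubexponentialSzpiro := by
  intro ε hε
  obtain ⟨C₁, hC₁⟩ := hX 1 one_pos
  have hlog2 : (0 : ℝ) < Real.log 2 := Real.log_pos one_lt_two
  refine ⟨(7 * (2 / ε) ^ 2 + max C₁ 0 * (1 / ε)) / Real.log 2, fun W _ => ?_⟩
  have hN1 : (1 : ℝ) ≤ (W.conductorNorm ℤ : ℝ) := by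
    exact_mod_cast WeierstrassCurve.conductorNorm_pos_holds W
  have hN0 : (0 : ℝ) ≤ (W.conductorNorm ℤ : ℝ) := by linarith
  have hlogN : 0 ≤ Real.log (W.conductorNorm ℤ : ℝ) := Real.log_nonneg hN1
  have hC0 : 0 ≤ max C₁ 0 := le_max_right _ _
  have hB : 0 ≤ 7 * Real.log (W.conductorNorm ℤ : ℝ) + max C₁ 0 := by positivity
  -- sum the towers
  have hcore : Real.log (W.minimalDiscriminantNorm ℤ : ℝ) ≤
      ((W.conductorNorm ℤ).primeFactors.card : ℝ) * (7 * Real.log (W.conductorNorm ℤ : ℝ) + max C₁ 0) :=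
    log_minimalDiscriminantNorm_le_card_mul W fun v =>
      (hC₁ W v).trans (add_le_add (by norm_num) (le_max_left _ _))
  -- count the towers
  have hcard : ((W.conductorNorm ℤ).primeFactors.card : ℝ) ≤
      Real.log (W.conductorNorm ℤ : ℝ) / Real.log 2 := by
    rw [le_div_iff₀ hlog2]
    exact card_primeFactors_mul_log_two_le (WeierstrassCurve.conductorNorm_pos_holds W).ne'
  -- logs against powers
  have hl1 : Real.log (W.conductorNorm ℤ : ℝ) ≤ (1 / ε) * (W.conductorNorm ℤ : ℝ) ^ ε := by
    calc Real.log (W.conductorNorm ℤ : ℝ) ≤ (W.conductorNorm ℤ : ℝ) ^ ε / ε :=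
          Real.log_le_rpow_div hN0 hε
      _ = (1 / ε) * (W.conductorNorm ℤ : ℝ) ^ ε := by ring
  have hl2 : Real.log (W.conductorNorm ℤ : ℝ) ^ 2 ≤ (2 / ε) ^ 2 * (W.conductorNorm ℤ : ℝ) ^ ε :=
    log_sq_le_rpow hN1 hε
  calc Real.log (W.minimalDiscriminantNorm ℤ : ℝ)
      ≤ ((W.conductorNorm ℤ).primeFactors.card : ℝ) *
          (7 * Real.log (W.conductorNorm ℤ : ℝ) + max C₁ 0) := hcore
    _ ≤ Real.log (W.conductorNorm ℤ : ℝ) / Real.log 2 *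
          (7 * Real.log (W.conductorNorm ℤ : ℝ) + max C₁ 0) :=
        mul_le_mul_of_nonneg_right hcard hB
    _ = (7 * Real.log (W.conductorNorm ℤ : ℝ) ^ 2 + max C₁ 0 * Real.log (W.conductorNorm ℤ : ℝ)) /
          Real.log 2 := by ring
    _ ≤ (7 * ((2 / ε) ^ 2 * (W.conductorNorm ℤ : ℝ) ^ ε) +
          max C₁ 0 * ((1 / ε) * (W.conductorNorm ℤ : ℝ) ^ ε)) / Real.log 2 := by
        gcongr
    _ = (7 * (2 / ε) ^ 2 + max C₁ 0 * (1 / ε)) / Real.log 2 * (W.conductorNorm ℤ : ℝ) ^ ε := by ring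

/-- **Item stmt-ABC-22412 `PlacewisePayoff` (route PlacewiseSzpiro, support, rank 9).** The crux
`SingleTowerSzpiro` implies the sub-exponential Szpiro bound `∀ ε > 0, ∃ C, ∀ E/ℚ, log |Δ_min(E)| ≤ C · N_E^ε`
— the conclusion is verbatim `Summit.ABC.Harvest.SubexponentialSzpiro`, so this is
`subexponentialSzpiro_of_singleTowerSzpiro` at the route's spelling. Certified content of the line, not progress on
the crux; «A1′ — NOT abc». [folklore] -/
theorem placewisePayoff_proof : Summit.ABC.ABC.Theses.PlacewiseSzpiro.PlacewisePayoff := by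
  unfold PlacewisePayoff
  intro hX
  exact subexponentialSzpiro_of_singleTowerSzpiro hX

end Summit.ABC.ABC.Theorems

end
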